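import Summits.Ventures.PackingBounds.Configurations.FivePointConfigs
import Summits.Ventures.PackingBounds.Configurations.D4NotUniversallyOptimal

/-!
# There is no universally optimal configuration of five points on `S²`

Framing: lottery ticket; floor = certified bounds/negative ranges. Venture `PackingBounds` (cell
`pub-packcert`, seat `pub-packcert-energy`) — the NEGATIVE side of the `(n, N) = (3, 5)` energy row (the cell's
certified LP brackets for `5` points on `S²` have an irreducible gap; this file says no configuration is optimal
for all completely monotone potentials at once).

Cohn–Kumar (2007, §1, p. 102): universal optimality "provably fails in the case of five points on `S²`": a
universally optimal code is an optimal spherical code, the optimal `5`-point codes are an antipodal pair with three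
points on the orthogonal great circle (Schütte–van der Waerden), among those only the equilateral one (the triangular
bipyramid) can be universally optimal, and for `f(r) = (4 - r)^7 ∝ (1+t)^7` a square pyramid has smaller energy.
The proof formalised here replaces the Schütte–van der Waerden step by an energy/Laplacian argument:
(1) minimality for every `(1+t)^k` against the bipyramid forces all inner products `≤ 0`
(`inner_le_of_ckPow_optimal`, `D4NotUniversallyOptimal.lean`) and, at `k = 1`, `Σ x = 0`;
(2) five pairwise non-acute unit vectors of `ℝ³` summing to zero have the bipyramid's distance distribution
`{-1 (×2), 0 (×12), -1/2 (×6)}` (`energy_eq_bipyramid`): the Gram matrix is a graph Laplacian of rank `≤ 3`, so its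
kernel contains a non-constant vector, whose top level set splits the points into two mutually orthogonal zero-sum
parts of sizes `2` and `3`; (3) the square pyramid of `FivePointConfigs.lean` beats that distribution for
`(1+t)^7` (`11.9092… < 12.046875`). Main statement: `no_universallyOptimal_card5`.

Reference: H. Cohn, A. Kumar, *Universally optimal distribution of points on spheres*, J. Amer. Math. Soc. 20
(2007) 99–148, §1. [`CohnKumar2006`]
-/

noncomputable section

namespace Summit.Ventures.PackingBounds.Config

open Finset Module

/-! ### Step 1: the `(1+t)¹`-energy controls the centre of mass -/
/-- For unit vectors, `Σ_{x ≠ y} (1 + ⟪x,y⟫) = |C|² - 2|C| + ‖Σ_x x‖²`. [folklore] -/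
theorem ckPow_one_energy_eq {n : ℕ} (C : Finset (EuclideanSpace ℝ (Fin n))) (h1 : ∀ x ∈ C, ‖x‖ = 1) :
    ∑ x ∈ C, ∑ y ∈ C.erase x, (1 + inner ℝ x y) ^ 1 =
      (C.card : ℝ) ^ 2 - 2 * C.card + ‖∑ x ∈ C, x‖ ^ 2 := by
  classical
  have hnorm : ‖∑ x ∈ C, x‖ ^ 2 = ∑ x ∈ C, ∑ y ∈ C, inner ℝ x y := by
    rw [← real_inner_self_eq_norm_sq, sum_inner]
    exact Finset.sum_congr rfl fun x _ => inner_sum _ _ _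
  have hdiag : ∀ x ∈ C, ∑ y ∈ C.erase x, (1 + inner ℝ x y) ^ 1 =
      ∑ y ∈ C, (1 + inner ℝ x y) - 2 := by
    intro x hx
    rw [← Finset.sum_erase_add _ _ hx, real_inner_self_eq_norm_sq, h1 x hx]
    simp only [pow_one]
    ring
  rw [Finset.sum_congr rfl hdiag, Finset.sum_sub_distrib, hnorm]
  simp only [Finset.sum_add_distrib, Finset.sum_const, nsmul_eq_mul]
  ring

/-- A configuration of unit vectors whose `(1+t)¹`-energy is at most that of a zero-sum configuration of the same
size sums to zero itself. [folklore] -/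
theorem sum_eq_zero_of_ckPow_one_le {n : ℕ} (C₀ C : Finset (EuclideanSpace ℝ (Fin n)))
    (h₀ : ∀ x ∈ C₀, ‖x‖ = 1) (h1 : ∀ x ∈ C, ‖x‖ = 1) (hcard : C₀.card = C.card)
    (hC : ∑ x ∈ C, x = 0)
    (hle : ∑ x ∈ C₀, ∑ y ∈ C₀.erase x, (1 + inner ℝ x y) ^ 1 ≤
      ∑ x ∈ C, ∑ y ∈ C.erase x, (1 + inner ℝ x y) ^ 1) :
    ∑ x ∈ C₀, x = 0 := by
  rw [ckPow_one_energy_eq C₀ h₀, ckPow_one_energy_eq C h1, hcard, hC, norm_zero] at hle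
  have h : ‖∑ x ∈ C₀, x‖ ^ 2 ≤ 0 := by linarith
  have h' : ‖∑ x ∈ C₀, x‖ = 0 := by nlinarith [norm_nonneg (∑ x ∈ C₀, x)]
  exact norm_eq_zero.mp h'

/-! ### Step 2: five pairwise non-acute unit vectors of `ℝ³` summing to zero form a bipyramid -/
section structure3

variable {ι : Type*} [Fintype ι] (x : ι → EuclideanSpace ℝ (Fin 3))

/-- Row sums of the Gram matrix vanish: `Σ_j ⟪x_i, x_j⟫ = 0`. -/
theorem gram_rowsum_eq_zero (hsum : ∑ i, x i = 0) (i : ι) : ∑ j, inner ℝ (x i) (x j) = 0 := by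
  rw [← inner_sum, hsum, inner_zero_right]

/-- `‖Σ a_i x_i‖² = Σ_{i,j} a_i a_j ⟪x_i, x_j⟫`. -/
theorem norm_sq_combo (a : ι → ℝ) :
    ‖∑ i, a i • x i‖ ^ 2 = ∑ i, ∑ j, a i * a j * inner ℝ (x i) (x j) := by
  rw [← real_inner_self_eq_norm_sq, sum_inner]
  refine Finset.sum_congr rfl fun i _ => ?_
  rw [inner_sum]
  refine Finset.sum_congr rfl fun j _ => ?_
  rw [real_inner_smul_left, real_inner_smul_right]; ring

/-- **Laplacian step.** If `Σ a_i x_i = 0` then `a` is constant along every pair with `⟪x_i, x_j⟫ ≠ 0`: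
`a_i ≠ a_j → ⟪x_i, x_j⟫ = 0`. (`0 = ‖Σ a_i x_i‖² = -½ Σ_{i,j} (-⟪x_i,x_j⟫)(a_i - a_j)²`, a sum of nonpositive terms.) -/
theorem inner_eq_zero_of_ne (hx0 : ∀ i j, i ≠ j → inner ℝ (x i) (x j) ≤ 0) (hsum : ∑ i, x i = 0)
    {a : ι → ℝ} (ha : ∑ i, a i • x i = 0) {i j : ι} (hij : a i ≠ a j) :
    inner ℝ (x i) (x j) = 0 := by
  classical
  have hquad : ∑ i, ∑ j, a i * a j * inner ℝ (x i) (x j) = 0 := by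
    rw [← norm_sq_combo x a, ha, norm_zero]; ring
  have hrow := gram_rowsum_eq_zero x hsum
  -- `Σ_{i,j} ⟪x_i,x_j⟫ (a_i - a_j)² = 0`
  have hS : ∑ i, ∑ j, inner ℝ (x i) (x j) * (a i - a j) ^ 2 = 0 := by
    have hexp : ∀ i j, inner ℝ (x i) (x j) * (a i - a j) ^ 2 =
        a i ^ 2 * inner ℝ (x i) (x j) + a j ^ 2 * inner ℝ (x i) (x j) -
          2 * (a i * a j * inner ℝ (x i) (x j)) := fun i j => by ring
    simp_rw [hexp, Finset.sum_sub_distrib, Finset.sum_add_distrib, ← Finset.mul_sum, hrow, mul_zero,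
      Finset.sum_const_zero, zero_add, hquad]
    rw [Finset.sum_comm]
    simp_rw [← Finset.mul_sum]
    have hsym : ∀ j, ∑ i, inner ℝ (x i) (x j) = 0 := fun j => by
      rw [show ∑ i, inner ℝ (x i) (x j) = ∑ i, inner ℝ (x j) (x i) from
        Finset.sum_congr rfl fun i _ => real_inner_comm _ _]
      exact hrow j
    simp [hsym]
  -- every term is `≤ 0`, hence `= 0`
  have hle : ∀ i j, inner ℝ (x i) (x j) * (a i - a j) ^ 2 ≤ 0 := by
    intro i j
    by_cases h : i = j
    · subst h; simp
    · exact mul_nonpos_of_nonpos_of_nonneg (hx0 i j h) (sq_nonneg _)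
  have hterm : ∀ i j, inner ℝ (x i) (x j) * (a i - a j) ^ 2 = 0 := by
    intro i j
    have h0 : ∑ i, ∑ j, -(inner ℝ (x i) (x j) * (a i - a j) ^ 2) = 0 := by
      simp only [Finset.sum_neg_distrib, hS, neg_zero]
    have hnn : ∀ i ∈ (univ : Finset ι), 0 ≤ ∑ j, -(inner ℝ (x i) (x j) * (a i - a j) ^ 2) :=
      fun i _ => Finset.sum_nonneg fun j _ => by linarith [hle i j]
    have hi := (Finset.sum_eq_zero_iff_of_nonneg hnn).mp h0 i (mem_univ i)
    have hj := (Finset.sum_eq_zero_iff_of_nonneg fun j _ => by linarith [hle i j]).mp hi j (mem_univ j)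
    linarith
  have h := hterm i j
  rcases mul_eq_zero.mp h with h | h
  · exact h
  · exact absurd (sub_eq_zero.mp (pow_eq_zero_iff two_ne_zero |>.mp h)) hij

/-- **Rank step.** If `|ι| = 5`, the kernel of `a ↦ Σ a_i x_i` (dimension `≥ 5 - 3 = 2`) contains a non-constant
vector. -/
theorem exists_nonconst_relation (hcard : Fintype.card ι = 5) :
    ∃ a : ι → ℝ, ∑ i, a i • x i = 0 ∧ ∃ i j, a i ≠ a j := by
  classical
  let L : (ι → ℝ) →ₗ[ℝ] EuclideanSpace ℝ (Fin 3) :=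
    { toFun := fun a => ∑ i, a i • x i
      map_add' := fun a b => by simp [add_smul, Finset.sum_add_distrib]
      map_smul' := fun r a => by simp [Finset.smul_sum, smul_smul] }
  have hLapp : ∀ a, L a = ∑ i, a i • x i := fun a => rfl
  -- rank–nullity
  have hrn := LinearMap.finrank_range_add_finrank_ker L
  have hdom : finrank ℝ (ι → ℝ) = 5 := by rw [Module.finrank_fintype_fun_eq_card, hcard]
  have hrange : finrank ℝ (LinearMap.range L) ≤ 3 := by
    have h := Submodule.finrank_le (LinearMap.range L)
    rw [finrank_euclideanSpace_fin] at h
    exact h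
  have hker : 2 ≤ finrank ℝ (LinearMap.ker L) := by omega
  -- a kernel of dimension ≥ 2 is not inside the line of constant vectors
  by_contra hcon
  push Not at hcon
  have hsub : LinearMap.ker L ≤ Submodule.span ℝ {fun _ : ι => (1 : ℝ)} := by
    intro a ha
    rw [LinearMap.mem_ker, hLapp] at ha
    have hc := hcon a ha
    obtain ⟨i₀⟩ : Nonempty ι := Fintype.card_pos_iff.mp (by omega)
    rw [Submodule.mem_span_singleton]
    exact ⟨a i₀, funext fun i => by simp [hc i i₀]⟩
  have h1 : finrank ℝ (Submodule.span ℝ ({fun _ : ι => (1 : ℝ)} : Set (ι → ℝ))) ≤ 1 := by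
    simpa using finrank_span_le_card ({fun _ : ι => (1 : ℝ)} : Set (ι → ℝ))
  have := Submodule.finrank_mono hsub
  omega

omit [Fintype ι] in
/-- A zero-sum part has at least two points. -/
theorem two_le_card_of_sum_eq_zero (hx1 : ∀ i, ‖x i‖ = 1) (P : Finset ι) (hP : P.Nonempty) (h0 : ∑ i ∈ P, x i = 0) :
    2 ≤ P.card := by
  by_contra hlt
  obtain ⟨i, hi⟩ := hP
  have hP1 : P.card = 1 := by have := Finset.card_pos.mpr ⟨i, hi⟩; omega
  obtain ⟨j, hj⟩ := Finset.card_eq_one.mp hP1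
  rw [hj, Finset.sum_singleton] at h0
  have := hx1 j
  rw [h0, norm_zero] at this
  exact zero_ne_one this

omit [Fintype ι] in
/-- A zero-sum pair is antipodal: `⟪x_i, x_j⟫ = -1`. -/
theorem inner_eq_neg_one_of_pair (hx1 : ∀ i, ‖x i‖ = 1) {i j : ι} (h0 : x i + x j = 0) :
    inner ℝ (x i) (x j) = -1 := by
  have hj : x j = -x i := by rw [← add_eq_zero_iff_eq_neg.mp (by rwa [add_comm] at h0)]
  rw [hj, inner_neg_right, real_inner_self_eq_norm_sq, hx1 i]; norm_num

omit [Fintype ι] in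
/-- In a zero-sum triple every inner product is `-1/2`. -/
theorem inner_eq_neg_half_of_triple (hx1 : ∀ i, ‖x i‖ = 1) {i j l : ι} (h0 : x i + x j + x l = 0) :
    inner ℝ (x i) (x j) = -1 / 2 := by
  have h : x i + x j = -x l := add_eq_zero_iff_eq_neg.mp h0
  have hn : ‖x i + x j‖ ^ 2 = 1 := by rw [h, norm_neg, hx1 l]; norm_num
  rw [← real_inner_self_eq_norm_sq, inner_add_left, inner_add_right, inner_add_right,
    real_inner_self_eq_norm_sq, real_inner_self_eq_norm_sq, hx1 i, hx1 j] at hn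
  have hc : inner ℝ (x j) (x i) = inner ℝ (x i) (x j) := real_inner_comm _ _
  linarith

/-- Energy of a split configuration: a pair part `P` and a triple part `Q`, mutually orthogonal, each zero-sum,
give the bipyramid distance distribution. -/
theorem sum_sum_eq_of_parts [DecidableEq ι] (f : ℝ → ℝ) (P Q : Finset ι) (hPQ : Disjoint P Q) (hU : P ∪ Q = univ)
    (hP : P.card = 2) (hQ : Q.card = 3)
    (hPin : ∀ i ∈ P, ∀ j ∈ P, i ≠ j → inner ℝ (x i) (x j) = -1)
    (hQin : ∀ i ∈ Q, ∀ j ∈ Q, i ≠ j → inner ℝ (x i) (x j) = -1 / 2)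
    (hcross : ∀ i ∈ P, ∀ j ∈ Q, inner ℝ (x i) (x j) = 0) (hx1' : ∀ i, inner ℝ (x i) (x i) = 1) :
    ∑ i, ∑ j, f (inner ℝ (x i) (x j)) = 5 * f 1 + 2 * f (-1) + 6 * f (-1 / 2) + 12 * f 0 := by
  have hcross' : ∀ i ∈ Q, ∀ j ∈ P, inner ℝ (x i) (x j) = 0 := fun i hi j hj => by
    rw [real_inner_comm]; exact hcross j hj i hi
  -- split both sums along `univ = P ∪ Q`
  have hsplit : ∀ g : ι → ℝ, ∑ i, g i = ∑ i ∈ P, g i + ∑ i ∈ Q, g i := fun g => by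
    rw [← hU, Finset.sum_union hPQ]
  obtain ⟨p, q, hpq, rfl⟩ := Finset.card_eq_two.mp hP
  obtain ⟨a, b, c, hab, hac, hbc, rfl⟩ := Finset.card_eq_three.mp hQ
  rw [hsplit]
  simp_rw [hsplit]
  -- membership facts
  have hp : p ∈ ({p, q} : Finset ι) := by simp
  have hq : q ∈ ({p, q} : Finset ι) := by simp
  have ha : a ∈ ({a, b, c} : Finset ι) := by simp
  have hb : b ∈ ({a, b, c} : Finset ι) := by simp
  have hc : c ∈ ({a, b, c} : Finset ι) := by simp
  simp only [Finset.sum_insert, Finset.sum_singleton, Finset.mem_insert, Finset.mem_singleton, hpq, hab,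
    hac, hbc, or_self, not_false_eq_true]
  rw [hx1' p, hx1' q, hx1' a, hx1' b, hx1' c,
    hPin p hp q hq hpq, hPin q hq p hp hpq.symm,
    hQin a ha b hb hab, hQin a ha c hc hac, hQin b hb a ha hab.symm, hQin b hb c hc hbc,
    hQin c hc a ha hac.symm, hQin c hc b hb hbc.symm,
    hcross p hp a ha, hcross p hp b hb, hcross p hp c hc, hcross q hq a ha, hcross q hq b hb, hcross q hq c hc,
    hcross' a ha p hp, hcross' a ha q hq, hcross' b hb p hp, hcross' b hb q hq, hcross' c hc p hp,
    hcross' c hc q hq]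
  ring

/-- **Structure theorem (indexed form).** Five pairwise non-acute unit vectors of `ℝ³` summing to zero have the
distance distribution of the triangular bipyramid: for every `f`,
`Σ_{i,j} f(⟪x_i,x_j⟫) = 5 f(1) + 2 f(-1) + 6 f(-1/2) + 12 f(0)`. -/
theorem sum_sum_eq_bipyramid (hx1 : ∀ i, ‖x i‖ = 1) (hx0 : ∀ i j, i ≠ j → inner ℝ (x i) (x j) ≤ 0)
    (hsum : ∑ i, x i = 0) (hcard : Fintype.card ι = 5) (f : ℝ → ℝ) :
    ∑ i, ∑ j, f (inner ℝ (x i) (x j)) = 5 * f 1 + 2 * f (-1) + 6 * f (-1 / 2) + 12 * f 0 := by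
  classical
  obtain ⟨a, ha, i₁, j₁, hne⟩ := exists_nonconst_relation x hcard
  -- top level set `S` of `a` and its complement `T`
  obtain ⟨i₀, -, hmax⟩ := Finset.exists_max_image univ a (univ_nonempty_iff.mpr ⟨i₁⟩)
  set S := univ.filter fun i => a i = a i₀ with hS
  set T := univ.filter fun i => ¬ a i = a i₀ with hT
  have hST : Disjoint S T := Finset.disjoint_filter_filter_not _ _ _
  have hUnion : S ∪ T = univ := Finset.filter_union_filter_not_eq _ _
  have hcardST : S.card + T.card = 5 := by
    rw [hS, hT, Finset.card_filter_add_card_filter_not, card_univ, hcard]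
  -- orthogonality across the split
  have horth : ∀ i ∈ S, ∀ j ∈ T, inner ℝ (x i) (x j) = 0 := by
    intro i hi j hj
    simp only [hS, hT, mem_filter, mem_univ, true_and] at hi hj
    exact inner_eq_zero_of_ne x hx0 hsum ha (by rw [hi]; exact Ne.symm hj)
  -- zero sums of the parts
  have hrow := gram_rowsum_eq_zero x hsum
  have hsumS : ∑ i ∈ S, x i = 0 := by
    have hn : ‖∑ i ∈ S, x i‖ ^ 2 = 0 := by
      rw [← real_inner_self_eq_norm_sq, sum_inner]
      refine Finset.sum_eq_zero fun i hi => ?_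
      rw [inner_sum]
      have h := hrow i
      rw [← hUnion, Finset.sum_union hST] at h
      have hT0 : ∑ j ∈ T, inner ℝ (x i) (x j) = 0 := Finset.sum_eq_zero fun j hj => horth i hi j hj
      linarith
    exact norm_eq_zero.mp (pow_eq_zero_iff two_ne_zero |>.mp hn)
  have hsumT : ∑ i ∈ T, x i = 0 := by
    have h := hsum
    rw [← hUnion, Finset.sum_union hST, hsumS, zero_add] at h
    exact h
  -- sizes
  have hSne : S.Nonempty := ⟨i₀, by simp [hS]⟩
  have hTne : T.Nonempty := by
    by_contra h
    rw [Finset.not_nonempty_iff_eq_empty, hT, filter_eq_empty_iff] at h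
    have h1 : a i₁ = a i₀ := by simpa using h (mem_univ i₁)
    have h2 : a j₁ = a i₀ := by simpa using h (mem_univ j₁)
    exact hne (h1.trans h2.symm)
  have h2S := two_le_card_of_sum_eq_zero x hx1 S hSne hsumS
  have h2T := two_le_card_of_sum_eq_zero x hx1 T hTne hsumT
  have hx1' : ∀ i, inner ℝ (x i) (x i) = 1 := fun i => by
    rw [real_inner_self_eq_norm_sq, hx1 i]; norm_num
  -- inner products inside a part of size 2 / 3
  have hpair : ∀ P : Finset ι, P.card = 2 → ∑ i ∈ P, x i = 0 →
      ∀ i ∈ P, ∀ j ∈ P, i ≠ j → inner ℝ (x i) (x j) = -1 := by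
    intro P hP h0 i hi j hj hij
    obtain ⟨p, q, hpq, rfl⟩ := Finset.card_eq_two.mp hP
    rw [Finset.sum_pair hpq] at h0
    simp only [mem_insert, mem_singleton] at hi hj
    rcases hi with rfl | rfl <;> rcases hj with rfl | rfl
    · exact absurd rfl hij
    · exact inner_eq_neg_one_of_pair x hx1 h0
    · exact inner_eq_neg_one_of_pair x hx1 (by rwa [add_comm] at h0)
    · exact absurd rfl hij
  have htriple : ∀ P : Finset ι, P.card = 3 → ∑ i ∈ P, x i = 0 →
      ∀ i ∈ P, ∀ j ∈ P, i ≠ j → inner ℝ (x i) (x j) = -1 / 2 := by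
    intro P hP h0 i hi j hj hij
    obtain ⟨p, q, r, hpq, hpr, hqr, rfl⟩ := Finset.card_eq_three.mp hP
    rw [Finset.sum_insert (by simp [hpq, hpr]), Finset.sum_pair hqr] at h0
    have e1 : x p + x q + x r = 0 := by rw [← h0]; abel
    have e2 : x q + x p + x r = 0 := by rw [← h0]; abel
    have e3 : x p + x r + x q = 0 := by rw [← h0]; abel
    have e4 : x r + x p + x q = 0 := by rw [← h0]; abel
    have e5 : x q + x r + x p = 0 := by rw [← h0]; abel
    have e6 : x r + x q + x p = 0 := by rw [← h0]; abel
    simp only [mem_insert, mem_singleton] at hi hj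
    rcases hi with rfl | rfl | rfl <;> rcases hj with rfl | rfl | rfl
    · exact absurd rfl hij
    · exact inner_eq_neg_half_of_triple x hx1 e1
    · exact inner_eq_neg_half_of_triple x hx1 e3
    · exact inner_eq_neg_half_of_triple x hx1 e2
    · exact absurd rfl hij
    · exact inner_eq_neg_half_of_triple x hx1 e5
    · exact inner_eq_neg_half_of_triple x hx1 e4
    · exact inner_eq_neg_half_of_triple x hx1 e6
    · exact absurd rfl hij
  -- the two cases `|S| = 2, |T| = 3` and `|S| = 3, |T| = 2`
  rcases Nat.lt_or_ge S.card 3 with hlt | hge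
  · have hS2 : S.card = 2 := by omega
    have hT3 : T.card = 3 := by omega
    exact sum_sum_eq_of_parts x f S T hST hUnion hS2 hT3 (hpair S hS2 hsumS) (htriple T hT3 hsumT) horth hx1'
  · have hS3 : S.card = 3 := by omega
    have hT2 : T.card = 2 := by omega
    refine sum_sum_eq_of_parts x f T S hST.symm (by rw [union_comm, hUnion]) hT2 hS3 (hpair T hT2 hsumT)
      (htriple S hS3 hsumS) (fun i hi j hj => ?_) hx1'
    rw [real_inner_comm]; exact horth j hj i hi

end structure3

/-- **Structure theorem.** A `5`-point configuration of unit vectors of `ℝ³` with pairwise inner products `≤ 0`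
and centre of mass `0` has the energy of the triangular bipyramid for every potential:
`Σ_{x ≠ y} a(⟪x,y⟫) = 2a(-1) + 12a(0) + 6a(-1/2)`. -/
theorem energy_eq_bipyramid (C : Finset (EuclideanSpace ℝ (Fin 3))) (h1 : ∀ x ∈ C, ‖x‖ = 1)
    (hN : C.card = 5) (h0 : ∀ x ∈ C, ∀ y ∈ C, x ≠ y → inner ℝ x y ≤ 0) (hsum : ∑ x ∈ C, x = 0)
    (a : ℝ → ℝ) :
    ∑ x ∈ C, ∑ y ∈ C.erase x, a (inner ℝ x y) = 2 * a (-1) + 12 * a 0 + 6 * a (-1 / 2) := by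
  classical
  have hdiag : ∀ x ∈ C, ∑ y ∈ C.erase x, a (inner ℝ x y) = ∑ y ∈ C, a (inner ℝ x y) - a 1 := by
    intro x hx
    rw [← Finset.sum_erase_add _ _ hx, real_inner_self_eq_norm_sq, h1 x hx]
    norm_num
  rw [Finset.sum_congr rfl hdiag, Finset.sum_sub_distrib, sum_const, hN]
  -- pass to the index type `↥C`
  have key := sum_sum_eq_bipyramid (ι := ↥C) (fun i => (i : EuclideanSpace ℝ (Fin 3)))
    (fun i => h1 i i.2) (fun i j hij => h0 i i.2 j j.2 fun h => hij (Subtype.ext h))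
    (by rw [Finset.sum_coe_sort C (fun x => x)]; exact hsum) (by rw [Fintype.card_coe, hN]) a
  have hin : ∀ i : ↥C, ∑ j : ↥C, a (inner ℝ (i : EuclideanSpace ℝ (Fin 3)) (j : EuclideanSpace ℝ (Fin 3))) =
      ∑ y ∈ C, a (inner ℝ (i : EuclideanSpace ℝ (Fin 3)) y) :=
    fun i => Finset.sum_coe_sort C (fun y => a (inner ℝ (i : EuclideanSpace ℝ (Fin 3)) y))
  simp only [hin] at key
  rw [Finset.sum_coe_sort C (fun z => ∑ y ∈ C, a (inner ℝ z y))] at key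
  rw [key]
  simp only [nsmul_eq_mul, Nat.cast_ofNat]
  ring

/-! ### Step 3: no universally optimal five-point configuration -/
/-- The square pyramid beats the bipyramid distance distribution for `(1+t)^7`:
`8(21/25)^7 + 8(641/625)^7 + 4(32/625)^7 = 11.9092… < 12.046875 = 12 + 6/2^7`. [cite: CohnKumar2006, §1] -/
theorem SquarePyramid.ckPow7_energy_lt :
    ∑ x ∈ SquarePyramid.pts, ∑ y ∈ SquarePyramid.pts.erase x, (1 + inner ℝ x y) ^ 7 <
      2 * (1 + (-1 : ℝ)) ^ 7 + 12 * (1 + (0 : ℝ)) ^ 7 + 6 * (1 + (-1 / 2 : ℝ)) ^ 7 := by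
  rw [SquarePyramid.energy_pts (fun t => (1 + t) ^ 7)]
  norm_num

/-- **There is no universally optimal configuration of five points on `S²`** (Cohn–Kumar 2007, §1): no `5`-point
configuration of unit vectors of `ℝ³` minimises the `a`-energy among all `5`-point configurations for every `a`
absolutely monotonic on `[-1,1)`. Proof: such a `C₀` would minimise every `(1+t)^k`-energy; against the triangular
bipyramid this forces pairwise inner products `≤ 0` (`k → ∞`) and centre of mass `0` (`k = 1`), hence
(`energy_eq_bipyramid`) the bipyramid's energies — but Cohn–Kumar's square pyramid has smaller `(1+t)^7`-energy.
[cite: CohnKumar2006, §1 (five points on S²)] -/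
theorem no_universallyOptimal_card5 :
    ¬ ∃ C₀ : Finset (EuclideanSpace ℝ (Fin 3)), (∀ x ∈ C₀, ‖x‖ = 1) ∧ C₀.card = 5 ∧
      ∀ a : ℝ → ℝ, AbsolutelyMonotoneOn a (Set.Ico (-1) 1) →
        ∀ C : Finset (EuclideanSpace ℝ (Fin 3)), (∀ x ∈ C, ‖x‖ = 1) → C.card = 5 →
          ∑ x ∈ C₀, ∑ y ∈ C₀.erase x, a (inner ℝ x y) ≤
            ∑ x ∈ C, ∑ y ∈ C.erase x, a (inner ℝ x y) := by
  classical
  rintro ⟨C₀, h1, hN, hopt⟩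
  have hB := fun k : ℕ => hopt (fun t => (1 + t) ^ k) (absolutelyMonotoneOn_one_add_pow k)
    Bipyramid.pts Bipyramid.norm_pts Bipyramid.card_pts
  -- (a) optimal code: all inner products `≤ 0`
  have h0 : ∀ x ∈ C₀, ∀ y ∈ C₀, x ≠ y → inner ℝ x y ≤ 0 :=
    inner_le_of_ckPow_optimal C₀ Bipyramid.pts h1 hB Bipyramid.norm_pts (by norm_num) Bipyramid.inner_pts_le
  -- (b) centre of mass `0`, from `k = 1` (the bipyramid sums to zero: its `(1+t)¹`-energy is `15`)
  have hBsum : ∑ x ∈ Bipyramid.pts, x = 0 := by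
    have hE := Bipyramid.energy_pts (fun t => (1 + t) ^ 1)
    rw [ckPow_one_energy_eq _ Bipyramid.norm_pts, Bipyramid.card_pts] at hE
    have h : ‖∑ x ∈ Bipyramid.pts, x‖ ^ 2 = 0 := by linarith
    exact norm_eq_zero.mp (pow_eq_zero_iff two_ne_zero |>.mp h)
  have hsum : ∑ x ∈ C₀, x = 0 :=
    sum_eq_zero_of_ckPow_one_le C₀ Bipyramid.pts h1 Bipyramid.norm_pts (by rw [hN, Bipyramid.card_pts])
      hBsum (hB 1)
  -- (c) hence the bipyramid's energies; contradiction with the square pyramid at `k = 7`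
  have h7 := hopt (fun t => (1 + t) ^ 7) (absolutelyMonotoneOn_one_add_pow 7) SquarePyramid.pts
    SquarePyramid.norm_pts SquarePyramid.card_pts
  have hE7 := energy_eq_bipyramid C₀ h1 hN h0 hsum (fun t => (1 + t) ^ 7)
  beta_reduce at hE7
  rw [hE7] at h7
  exact absurd SquarePyramid.ckPow7_energy_lt (not_lt.2 h7)

end Summit.Ventures.PackingBounds.Config

end
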